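import Summits.Parity.GeneralizedHardyLittlewood.Theorems.FordMaynardNoSieveConst0164NegWitness0164Majorants

/-!
# Route `FordMaynardNoSieveConst0164`, crux `NegWitness0164` (stmt-Parity-19102), line `birth`,
# stub `stub_tweakNeg0164`: enclosure layer — the right-hand side of an α-family and the final polynomial step

Helper file toward the certificate stub (K. Ford, J. Maynard, *On the theory of prime producing sieves*,
arXiv:2407.14368, §8).  The right-hand side of (II') in `stub_tweakNeg0164_of_numerics'` (`…J3Lower`) is written with
the closed form of `K(α)` from `…J3Log` (two logarithms on each of two ranges).  Here it is simplified to Ford–Maynard's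
`1 + F₄(α)`: `1 + log(α/ν − 1)` for `α ≤ 1/2 + ν` and `1 + log((1/2)/(α − 1/2))` for `α ≥ 1/2 + ν` (`ν = 41/250`), the
form consumed by `F4_lower_chord_0164` / `neg_log_tangent_0164` (`…Majorants`).  Also the elementary termwise bound used
to certify a polynomial inequality on an interval from its Taylor coefficients.

* `rhs_family_lower_0164`, `rhs_family_upper_0164` — the two simplifications;
* `mul_pow_ge_min_0164` — `min q 0 · h^k ≤ q · x^k` for `0 ≤ x ≤ h`.

Def-free.  References: [FordMaynard2024PrimeSieves] arXiv:2407.14368, §8 ("F₄(α) = log(α/max(ν, α−1/2) − 1)").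
-/

noncomputable section

open Finset MeasureTheory Set
open scoped Classical
open Literature.NumberTheory.Sieve Literature.NumberTheory.Sieve.FordMaynard

namespace Summit.Parity.GeneralizedHardyLittlewood.FordMaynardNoSieveConst0164NegWitness0164

/-- **RHS of an α-family, lower regime** (`2ν < α`, `α < 1/2 + ν`): the (II') right-hand side equals
`1 + log(α/ν − 1)`. [cite: FordMaynard2024PrimeSieves, §8 ("F₄(α) = log(α/max(ν,α−1/2) − 1)")] -/
theorem rhs_family_lower_0164 {α : ℝ} (hα0 : 2 * (41 / 250) < α) (hα : α < 1 / 2 + 41 / 250) :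
    1 + α / 2 * (if 1 / 2 + 41 / 250 ≤ α then
        (Real.log ((1 / 2) / (α - 1 / 2)) - Real.log ((α - 1 / 2) / (α - (α - 1 / 2)))) / α
      else (Real.log ((α - 41 / 250) / (α - (α - 41 / 250))) - Real.log ((41 / 250) / (α - 41 / 250))) / α) =
      1 + Real.log (α / (41 / 250) - 1) := by
  rw [if_neg (not_le.mpr hα)]
  have hα' : (0 : ℝ) < α := by linarith
  have hpos : (0 : ℝ) < α - 41 / 250 := by linarith
  have h1 : (α - 41 / 250) / (α - (α - 41 / 250)) = (α - 41 / 250) / (41 / 250 : ℝ) := by congr 1; ring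
  have h2 : (41 / 250 : ℝ) / (α - 41 / 250) = ((α - 41 / 250) / (41 / 250))⁻¹ := by rw [inv_div]
  have h3 : (α - 41 / 250) / (41 / 250 : ℝ) = α / (41 / 250) - 1 := by field_simp
  rw [h1, h2, Real.log_inv, h3]
  field_simp
  ring

/-- **RHS of an α-family, upper regime** (`1/2 + ν ≤ α`): the (II') right-hand side equals
`1 + log((1/2)/(α − 1/2))`. [cite: FordMaynard2024PrimeSieves, §8 ("F₄(α) = log(α/max(ν,α−1/2) − 1)")] -/
theorem rhs_family_upper_0164 {α : ℝ} (hα : 1 / 2 + 41 / 250 ≤ α) :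
    1 + α / 2 * (if 1 / 2 + 41 / 250 ≤ α then
        (Real.log ((1 / 2) / (α - 1 / 2)) - Real.log ((α - 1 / 2) / (α - (α - 1 / 2)))) / α
      else (Real.log ((α - 41 / 250) / (α - (α - 41 / 250))) - Real.log ((41 / 250) / (α - 41 / 250))) / α) =
      1 + Real.log ((1 / 2) / (α - 1 / 2)) := by
  rw [if_pos hα]
  have hα' : (0 : ℝ) < α := by linarith
  have h1 : (α - 1 / 2) / (α - (α - 1 / 2)) = ((1 / 2 : ℝ) / (α - 1 / 2))⁻¹ := by
    rw [inv_div]; congr 1; ring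
  rw [h1, Real.log_inv]
  field_simp
  ring

/-- **Termwise Taylor-form bound**: for `0 ≤ x ≤ h`, `min q 0 · h^k ≤ q · x^k` (the term is nonnegative if `q ≥ 0`,
and at least `q h^k` if `q < 0`). Summing over the Taylor coefficients of a polynomial at the left endpoint certifies
its sign on `[0, h]`. [folklore] -/
theorem mul_pow_ge_min_0164 (q x h : ℝ) (k : ℕ) (hx0 : 0 ≤ x) (hxh : x ≤ h) :
    min q 0 * h ^ k ≤ q * x ^ k := by
  have hxk : 0 ≤ x ^ k := pow_nonneg hx0 k
  have hle : x ^ k ≤ h ^ k := pow_le_pow_left₀ hx0 hxh k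
  by_cases hq : 0 ≤ q
  · rw [min_eq_right hq, zero_mul]
    exact mul_nonneg hq hxk
  · push Not at hq
    rw [min_eq_left hq.le]
    exact mul_le_mul_of_nonpos_left hle hq.le

end Summit.Parity.GeneralizedHardyLittlewood.FordMaynardNoSieveConst0164NegWitness0164

end
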